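import Summits.KontsevichZagierPeriods.KontsevichZagierPeriods.Theorems.HurwitzMicroSectorsNormalFormPrincipleLevelOne
import Summits.KontsevichZagierPeriods.KontsevichZagierPeriods.Theorems.HurwitzMicroSectorsNormalFormPrincipleSlabASubPtK20
import Summits.KontsevichZagierPeriods.KontsevichZagierPeriods.Theorems.HurwitzMicroSectorsNormalFormPrincipleAlgCarriers
import Summits.KontsevichZagierPeriods.KontsevichZagierPeriods.Theorems.HurwitzMicroSectorsNormalFormPrincipleM2FiveZetaTwo

/-!
# `NormalFormPrinciple` (stmt-KontsevichZagierPeriods-3869), line `SketchIdeator1` — leaf `stub_boxRigidity`: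
# all weights, level `K`, totally off resonance: coordinate permutations of the weight-`w` box (rule 2)

Pure proof file (`--supports` the crux). Registered sub-goal `permN` of the layer "Conjecture 1 for
the boxes `[(0,1)^w, c (Π_l x_l^{e_l})/(1 − Π_l x_l^K)]` totally off resonance" (lead file
`…WeightN`), for a level `K ≥ 1` and a real-algebraic coefficient `c`: for every permutation `σ` of
the `w` coordinates, the box representations with exponent vectors `e` and `e ∘ σ` differ by a KZ
relation. The box `N = [(0,1)^w, f]` is reindexed along `σ⁻¹`
(`KZ.of_sub_of_reindex_mem_relations`, rule 2: a coordinate permutation, `|det| = 1`); the open box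
`(0,1)^w` and the kernel `1 − Π_l x_l^K` are permutation invariant (`Equiv.prod_comp`), and
`Π_l x_{σ⁻¹ l}^{e_l} = Π_l x_l^{e_{σ l}}` (`Fintype.prod_equiv`), so the reindexed representation is
congruent (`KZ.of_sub_of_mem_relations_of_eqOn`, rule 1 with a zero integrand) to `N'`. Port of
`…PiBox.Weight3.w3_perm_box_sub_mem_relations` from `Fin 3` to `Fin w`.
References: M. Kontsevich, D. Zagier, *Periods* (2001), §1.2 rule (2). No new definitions.
-/

noncomputable section

open MeasureTheory Set
open Literature.NumberTheory.Transcendental Literature.NumberTheory.Transcendental.KZ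
open Literature.ModelTheory.ExponentialFields (IsSemialgebraic)

namespace Summit.KontsevichZagierPeriods.HurwitzMicroSectors.NormalFormPrinciple.PiBox.WeightN

/-- **Coordinate permutations of the open box `(0,1)^w`** (rule 2): if `N = [(0,1)^w, f]` and
`N' = [(0,1)^w, g]` with `f (x ∘ τ) = g x` for a permutation `τ` of the `w` coordinates, then
`[N] − [N'] ∈ relations`, by reindexing along `τ` (`KZ.of_sub_of_reindex_mem_relations`; the open
box is permutation invariant) and congruence of the integrands on the box. Port of
`…PiBox.Weight3.w3_perm_box_sub_mem_relations` to dimension `w`.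
[cite: KontsevichZagier2001, §1.2 rule (2)] -/
theorem wn_perm_box_sub_mem_relations {w : ℕ} (τ : Equiv.Perm (Fin w))
    (f g : (Fin w → ℝ) → ℝ) (N N' : IntegralRep w)
    (hNd : N.domain = {x | ∀ i, x i ∈ Set.Ioo (0:ℝ) 1}) (hNi : EqOn N.integrand f N.domain)
    (hN'd : N'.domain = {x | ∀ i, x i ∈ Set.Ioo (0:ℝ) 1}) (hN'i : EqOn N'.integrand g N'.domain)
    (hfg : ∀ x : Fin w → ℝ, f (fun i => x (τ i)) = g x) :
    of N - of N' ∈ relations := by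
  -- adapted from …PiBox.Weight3.w3_perm_box_sub_mem_relations (the dimension-3 model)
  have h1 := of_sub_of_reindex_mem_relations N τ
  have hd : (N.reindex τ).domain = {x | ∀ i, x i ∈ Set.Ioo (0:ℝ) 1} := by
    ext x
    simp only [IntegralRep.reindex_domain, hNd, mem_setOf_eq]
    exact ⟨fun h i => by simpa using h (τ.symm i), fun h i => h (τ i)⟩
  have h2 : of (N.reindex τ) - of N' ∈ relations := by
    refine of_sub_of_mem_relations_of_eqOn (hN'd.trans hd.symm) fun x hx => ?_
    have hx' : (fun i => x (τ i)) ∈ N.domain := hx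
    rw [IntegralRep.reindex_integrand]
    show N.integrand (fun i => x (τ i)) = N'.integrand x
    rw [hNi hx', hN'i (hN'd ▸ hd ▸ hx), hfg]
  have e : of N - of N' = (of N - of (N.reindex τ)) + (of (N.reindex τ) - of N') := by abel
  rw [e]
  exact relations.add_mem h1 h2

/-- Reindexing a monomial by a permutation `σ` of the coordinates:
`Π_l x_{σ⁻¹ l}^{e_l} = Π_l x_l^{e_{σ l}}`. [folklore] -/
theorem wn_prod_pow_perm_symm {w : ℕ} (σ : Equiv.Perm (Fin w)) (e : Fin w → ℕ)
    (x : Fin w → ℝ) : ∏ l, x (σ.symm l) ^ (e l) = ∏ l, x l ^ (e (σ l)) :=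
  (Fintype.prod_equiv σ (fun l => x l ^ (e (σ l))) (fun l => x (σ.symm l) ^ (e l))
    fun l => by rw [Equiv.symm_apply_apply]).symm

/-- The level-`K` box integrand read in permuted coordinates: with
`f x = c (Π_l x_l^{e_l})/(1 − Π_l x_l^K)` one has
`f (x ∘ σ⁻¹) = c (Π_l x_l^{e_{σ l}})/(1 − Π_l x_l^K)` (the kernel `1 − Π_l x_l^K` is permutation
invariant, `Equiv.prod_comp`). [folklore] -/
theorem wn_perm_integrand_identity {w : ℕ} (K : ℕ) (e : Fin w → ℕ) (σ : Equiv.Perm (Fin w))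
    (c : ℝ) (x : Fin w → ℝ) :
    c * (∏ l, x (σ.symm l) ^ (e l)) / (1 - ∏ l, x (σ.symm l) ^ K) =
      c * (∏ l, x l ^ (e (σ l))) / (1 - ∏ l, x l ^ K) := by
  have hk : ∏ l, x (σ.symm l) ^ K = ∏ l, x l ^ K := Equiv.prod_comp σ.symm (fun l => x l ^ K)
  rw [wn_prod_pow_perm_symm σ e x, hk]

/-- **Stub N2 (coordinate permutation of the weight-`w` level-`K` box, rule 2):** for any
`σ : Equiv.Perm (Fin w)` the exponent vector `e` of the box
`[(0,1)^w, c (Π_l x_l^{e_l})/(1 − Π_l x_l^K)]` may be replaced by `e ∘ σ` modulo relations: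
reindex the box along `σ⁻¹` (`KZ.of_sub_of_reindex_mem_relations`; the open box and the kernel are
permutation invariant) and use `Π_l x_{σ⁻¹ l}^{e_l} = Π_l x_l^{e_{σ l}}`.
[cite: KontsevichZagier2001, §1.2 rule (2)] -/
theorem permN (w : ℕ) (K : ℕ) (hK : 0 < K) (e : Fin w → ℕ) (σ : Equiv.Perm (Fin w)) (c : ℝ)
    (hc : IsAlgebraic ℚ c) (N N' : IntegralRep w)
    (hNd : N.domain = {x | ∀ i, x i ∈ Set.Ioo (0:ℝ) 1})
    (hNi : EqOn N.integrand (fun x => c * (∏ l, x l ^ (e l)) / (1 - ∏ l, x l ^ K)) N.domain)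
    (hN'd : N'.domain = {x | ∀ i, x i ∈ Set.Ioo (0:ℝ) 1})
    (hN'i : EqOn N'.integrand (fun x => c * (∏ l, x l ^ (e (σ l))) / (1 - ∏ l, x l ^ K)) N'.domain) :
    of N - of N' ∈ relations := by
  have _ := hK
  have _ := hc
  exact wn_perm_box_sub_mem_relations σ.symm _ _ N N' hNd hNi hN'd hN'i
    fun x => wn_perm_integrand_identity K e σ c x

end Summit.KontsevichZagierPeriods.HurwitzMicroSectors.NormalFormPrinciple.PiBox.WeightN
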